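import Mathlib
import HarnessLib
import Summits.Ventures.LatticeQCDFlow.Exactness.NCMCGeneralSpaceDoeblinPowerEveryStart
import Summits.Ventures.LatticeQCDFlow.Exactness.NCMCGeneralSpaceRestartChainStart

/-!
# The Jarzynski lane from EVERY initial configuration: along the restart chain with a minorised level sampler, `ΔF̂_n → ΔF` and reweighted observables converge whatever the first record

HONEST FRAMING: exact (Metropolis-corrected) sampling algorithms for lattice gauge theory;
figures of merit are autocorrelation/cost numbers at stated couplings and volumes; no
continuum-physics claim.

Venture `LatticeQCDFlow` (cell pub-lqcd), topic `Exactness`; FANOUT row 13 (`eng-snf`, GEN-18).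
NEW WORK of the cell, not a published result; no definition is introduced; nothing is cited as a
fact.  GEN-16/17 typed `latflow-snf`'s default (Jarzynski) lane with CORRELATED starts: the records
`ω₀, ω₁, …` form a Markov chain with kernel `(κF ∘ₖ K).comap s` (launch the protocol, relax the start
point with the level sampler `K`, launch again; `NCMCGeneralSpaceMarkovRun`), stationary under `P_F`;
with `K` minorised it is ergodic and `ΔF̂_n → ΔF` a.s. from `P_F`
(`NCMCGeneralSpaceMarkovErgodicCriteria`) and from `ν₀`-ALMOST EVERY initial configuration
(`NCMCGeneralSpaceRestartChainStart`).  The restart kernel is minorised in ONE step by `κF ∘ₘ m`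
(`measure_le_comp_comap`), so GEN-18's Liouville step (`NCMCGeneralSpaceDoeblinPowerEveryStart`)
removes the exceptional set: EVERY initial record law — every first record, every initial
configuration.

## Content (Crooks pair between finite weights, `Z₀ ≠ 0`; `K` Markov, `ν₀`-invariant, `m ≤ K(z, ·)`
## for all `z`, `m` finite non-zero)

* `CrooksPair.restartKernel_nHit_one_minorised` — `m(Ω) • ((m(Ω))⁻¹ (κF ∘ₘ m)) ≤ nHit R 1 ω` for the
  restart kernel `R = (κF ∘ₖ K).comap s`; `isProbabilityMeasure_normalised_bind_kernel`.
* **`CrooksPair.tendsto_sampleMean_restartChain_anyLaw`** — from EVERY initial record law `μ₀`: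
  `(1/n) Σ_{i<n} e^{−W(ω_i)} → Z₁/Z₀` a.s.; **`CrooksPair.tendsto_jarzynskiEstimate_restartChain_anyLaw`**
  — `ΔF̂_n → ΔF` a.s. (`e^{−ΔF} = Z₁/Z₀`); **`CrooksPair.tendsto_jarzynskiEstimate_restartChain_everyStart`**
  — the engine's form: first record launched from ANY configuration `x` (`μ₀ = κF x`), then `K`
  between launches: `ΔF̂_n → ΔF` almost surely, for EVERY `x`.
* **`CrooksPair.tendsto_reweighted_restartChain_anyLaw`** — reweighted end-point observables
  `Σ e^{−W_i} f(end_i) / Σ e^{−W_i} → Z₁⁻¹ ∫ f dν₁` a.s. from every initial record law (the population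
  value identified with GEN-16's by uniqueness of almost-sure limits under `P_F`).

NOT CLAIMED: rates for `ΔF̂_n` (the weight `e^{−W}` is unbounded; the burn-in bounds of
`NCMCGeneralSpaceDoeblinPower` cover bounded observables only); anything numerical.
-/

namespace Summit.Ventures.LatticeQCDFlow.Exactness.GeneralNCMC

open MeasureTheory ProbabilityTheory Set Filter Finset
open scoped ENNReal Topology

variable {Ω E : Type*} [MeasurableSpace Ω] [MeasurableSpace E]

/-- The normalised launched measure `(m(Ω))⁻¹ (κF ∘ₘ m)` is a probability law on records. -/
theorem isProbabilityMeasure_normalised_bind_kernel (κF : Kernel Ω E) [IsMarkovKernel κF]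
    {m : Measure Ω} [IsFiniteMeasure m] (hm0 : m univ ≠ 0) :
    IsProbabilityMeasure ((m univ)⁻¹ • m.bind κF) :=
  ⟨by rw [Measure.smul_apply, smul_eq_mul, bind_apply_univ_of_markov κF m,
    ENNReal.inv_mul_cancel hm0 (measure_ne_top _ _)]⟩

namespace CrooksPair

variable {ν₀ ν₁ : Measure Ω} [IsFiniteMeasure ν₀] [IsFiniteMeasure ν₁] {κF κR : Kernel Ω E}
  [IsMarkovKernel κF] [IsMarkovKernel κR] {s e : E → Ω} {W : E → ℝ}

omit [IsFiniteMeasure ν₀] [IsFiniteMeasure ν₁] [IsMarkovKernel κR] in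
/-- **The restart kernel is minorised in one step** (skeleton form): `m ≤ K(z, ·)` for all `z` gives
`m(Ω) • ((m(Ω))⁻¹ (κF ∘ₘ m)) ≤ nHit ((κF ∘ₖ K).comap s) 1 ω` for every record `ω`. -/
theorem restartKernel_nHit_one_minorised (K : Kernel Ω Ω) [IsMarkovKernel K]
    (h : CrooksPair ν₀ ν₁ κF κR s e W) {m : Measure Ω} [IsFiniteMeasure m] (hm0 : m univ ≠ 0)
    (hmin : ∀ z, m ≤ K z) (ω : E) :
    m univ • ((m univ)⁻¹ • m.bind κF) ≤ nHit ((κF ∘ₖ K).comap s h.measurable_s) 1 ω := by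
  rw [nHit_one, smul_smul, ENNReal.mul_inv_cancel hm0 (measure_ne_top _ _), one_smul]
  exact measure_le_comp_comap K κF h.measurable_s hmin ω

/-- **`(1/n) Σ_{i<n} e^{−W(ω_i)} → Z₁/Z₀` FROM EVERY INITIAL RECORD LAW** along the restart chain with a
minorised `ν₀`-invariant level sampler. -/
theorem tendsto_sampleMean_restartChain_anyLaw (K : Kernel Ω Ω) [IsMarkovKernel K]
    (h0 : ν₀ univ ≠ 0) (hK : Kernel.Invariant K ν₀) (h : CrooksPair ν₀ ν₁ κF κR s e W)
    {m : Measure Ω} [IsFiniteMeasure m] (hm0 : m univ ≠ 0) (hmin : ∀ z, m ≤ K z)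
    (μ₀ : Measure E) [IsProbabilityMeasure μ₀] :
    ∀ᵐ ω ∂(Kernel.trajMeasure (X := fun _ : ℕ => E) μ₀
        (fun n : ℕ => ((κF ∘ₖ K).comap s h.measurable_s).comap
          (fun hh : (j : ↥(Finset.Iic n)) → E => hh ⟨n, Finset.mem_Iic.2 le_rfl⟩)
          (measurable_pi_apply _))),
      Tendsto (fun n : ℕ => (∑ i ∈ range n, Real.exp (-W (ω i))) / n) atTop
        (𝓝 ((ν₀ univ)⁻¹ * ν₁ univ).toReal) := by
  haveI := isProbabilityMeasure_fwdPathLaw ν₀ h0 κF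
  haveI := isProbabilityMeasure_normalised_bind_kernel κF hm0
  have key := tendsto_sum_div_anyLaw_of_nHit_minorised (h.invariant_restartKernel K hK) hm0
    (restartKernel_nHit_one_minorised K h hm0 hmin) (φ := fun ε => Real.exp (-W ε))
    (Real.measurable_exp.comp h.measurable_W.neg) (h.integrable_exp_neg_work h0) μ₀
  rw [h.integral_exp_neg_work] at key
  exact key

/-- **`ΔF̂_n → ΔF` FROM EVERY INITIAL RECORD LAW** (`e^{−ΔF} = Z₁/Z₀`): the Jarzynski estimate along
the restart chain with a minorised `ν₀`-invariant level sampler converges almost surely, whatever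
the law of the first record. -/
theorem tendsto_jarzynskiEstimate_restartChain_anyLaw (K : Kernel Ω Ω) [IsMarkovKernel K]
    (h0 : ν₀ univ ≠ 0) (hK : Kernel.Invariant K ν₀) (h : CrooksPair ν₀ ν₁ κF κR s e W) {ΔF : ℝ}
    (hΔF : Real.exp (-ΔF) = ((ν₀ univ)⁻¹ * ν₁ univ).toReal) {m : Measure Ω} [IsFiniteMeasure m]
    (hm0 : m univ ≠ 0) (hmin : ∀ z, m ≤ K z) (μ₀ : Measure E) [IsProbabilityMeasure μ₀] :
    ∀ᵐ ω ∂(Kernel.trajMeasure (X := fun _ : ℕ => E) μ₀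
        (fun n : ℕ => ((κF ∘ₖ K).comap s h.measurable_s).comap
          (fun hh : (j : ↥(Finset.Iic n)) → E => hh ⟨n, Finset.mem_Iic.2 le_rfl⟩)
          (measurable_pi_apply _))),
      Tendsto (fun n : ℕ => jarzynskiEstimate (fun ε => Real.exp (-W ε)) (fun i : Fin n => ω i))
        atTop (𝓝 ΔF) := by
  have hpos : (0 : ℝ) < ((ν₀ univ)⁻¹ * ν₁ univ).toReal := by rw [← hΔF]; exact Real.exp_pos _
  filter_upwards [h.tendsto_sampleMean_restartChain_anyLaw K h0 hK hm0 hmin μ₀] with ω hω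
  have hmean : Tendsto (fun n : ℕ => sampleMean (fun ε => Real.exp (-W ε)) (fun i : Fin n => ω i))
      atTop (𝓝 ((ν₀ univ)⁻¹ * ν₁ univ).toReal) := by
    refine hω.congr fun n => ?_
    unfold sampleMean
    rw [Fin.sum_univ_eq_sum_range (fun i => Real.exp (-W (ω i))) n]
  have hlog := (hmean.log hpos.ne').neg
  rw [← hΔF, Real.log_exp, neg_neg] at hlog
  exact hlog

/-- **THE JARZYNSKI LANE FROM EVERY INITIAL CONFIGURATION.**  For every Crooks pair between finite
weights (`Z₀ ≠ 0`, `e^{−ΔF} = Z₁/Z₀`), every `ν₀`-invariant Markov level sampler `K` dominating a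
non-zero finite measure from every configuration, and EVERY initial configuration `x`: the engine's
record stream — first record launched from `x`, then `K` between launches — has `ΔF̂_n → ΔF`
almost surely. -/
theorem tendsto_jarzynskiEstimate_restartChain_everyStart (K : Kernel Ω Ω) [IsMarkovKernel K]
    (h0 : ν₀ univ ≠ 0) (hK : Kernel.Invariant K ν₀) (h : CrooksPair ν₀ ν₁ κF κR s e W) {ΔF : ℝ}
    (hΔF : Real.exp (-ΔF) = ((ν₀ univ)⁻¹ * ν₁ univ).toReal) {m : Measure Ω} [IsFiniteMeasure m]
    (hm0 : m univ ≠ 0) (hmin : ∀ z, m ≤ K z) (x : Ω) :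
    ∀ᵐ ω ∂(Kernel.trajMeasure (X := fun _ : ℕ => E) (κF x)
        (fun n : ℕ => ((κF ∘ₖ K).comap s h.measurable_s).comap
          (fun hh : (j : ↥(Finset.Iic n)) → E => hh ⟨n, Finset.mem_Iic.2 le_rfl⟩)
          (measurable_pi_apply _))),
      Tendsto (fun n : ℕ => jarzynskiEstimate (fun ε => Real.exp (-W ε)) (fun i : Fin n => ω i))
        atTop (𝓝 ΔF) :=
  h.tendsto_jarzynskiEstimate_restartChain_anyLaw K h0 hK hΔF hm0 hmin (κF x)

/-- **REWEIGHTED END-POINT OBSERVABLES FROM EVERY INITIAL RECORD LAW**: for every measurable `f` with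
`e^{−W} f(end) ∈ L¹(P_F)` (`Z₁ ≠ 0`), along the restart chain
`Σ_{i<n} e^{−W_i} f(end_i) / Σ_{i<n} e^{−W_i} → Z₁⁻¹ ∫ f dν₁` almost surely. -/
theorem tendsto_reweighted_restartChain_anyLaw (K : Kernel Ω Ω) [IsMarkovKernel K]
    (h0 : ν₀ univ ≠ 0) (h1 : ν₁ univ ≠ 0) (hK : Kernel.Invariant K ν₀)
    (h : CrooksPair ν₀ ν₁ κF κR s e W) {f : Ω → ℝ} (hfm : Measurable f)
    (hA : Integrable (fun ε => Real.exp (-W ε) * f (e ε)) (fwdPathLaw ν₀ κF))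
    {m : Measure Ω} [IsFiniteMeasure m] (hm0 : m univ ≠ 0) (hmin : ∀ z, m ≤ K z)
    (μ₀ : Measure E) [IsProbabilityMeasure μ₀] :
    ∀ᵐ ω ∂(Kernel.trajMeasure (X := fun _ : ℕ => E) μ₀
        (fun n : ℕ => ((κF ∘ₖ K).comap s h.measurable_s).comap
          (fun hh : (j : ↥(Finset.Iic n)) → E => hh ⟨n, Finset.mem_Iic.2 le_rfl⟩)
          (measurable_pi_apply _))),
      Tendsto (fun n : ℕ => (∑ i ∈ range n, Real.exp (-W (ω i)) * f (e (ω i))) /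
        ∑ i ∈ range n, Real.exp (-W (ω i))) atTop (𝓝 (((ν₁ univ)⁻¹).toReal * ∫ y, f y ∂ν₁)) := by
  haveI := isProbabilityMeasure_fwdPathLaw ν₀ h0 κF
  haveI := isProbabilityMeasure_normalised_bind_kernel κF hm0
  have hinv := h.invariant_restartKernel K hK
  have hD := restartKernel_nHit_one_minorised K h hm0 hmin
  have hφm : Measurable fun ε => Real.exp (-W ε) * f (e ε) :=
    (Real.measurable_exp.comp h.measurable_W.neg).mul (hfm.comp h.measurable_e)
  have hpos : (0 : ℝ) < ((ν₀ univ)⁻¹ * ν₁ univ).toReal :=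
    ENNReal.toReal_pos (mul_ne_zero (ENNReal.inv_ne_zero.2 (measure_ne_top ν₀ univ)) h1)
      (ENNReal.mul_ne_top (ENNReal.inv_ne_top.2 h0) (measure_ne_top ν₁ univ))
  -- the value of the limit is GEN-16's, by uniqueness of almost sure limits under `P_F`
  have hErg := ergodic_shift_chain_of_nHit_minorised (κ := (κF ∘ₖ K).comap s h.measurable_s) hinv
    hm0 (fun z t ht => minorised_setwise hD z ht)
  have hval : (∫ ε, Real.exp (-W ε) * f (e ε) ∂(fwdPathLaw ν₀ κF)) /
      ((ν₀ univ)⁻¹ * ν₁ univ).toReal = ((ν₁ univ)⁻¹).toReal * ∫ y, f y ∂ν₁ := by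
    have hA' := tendsto_sum_div_anyLaw_of_nHit_minorised hinv hm0 hD hφm hA (fwdPathLaw ν₀ κF)
    have hB' := h.tendsto_sampleMean_restartChain_anyLaw K h0 hK hm0 hmin (fwdPathLaw ν₀ κF)
    have hC' := tendsto_reweighted_ae_of_ergodic h0 h1 h hfm hA hErg
      (chain_map_eval_of_invariant _ hinv 0)
    obtain ⟨ω, ⟨hωA, hωB⟩, hωC⟩ := ((hA'.and hB').and hC').exists
    have hrat := hωA.div hωB hpos.ne'
    have hrat' : Tendsto (fun n : ℕ => (∑ i ∈ range n, Real.exp (-W (ω i)) * f (e (ω i))) /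
        ∑ i ∈ range n, Real.exp (-W (ω i))) atTop
        (𝓝 ((∫ ε, Real.exp (-W ε) * f (e ε) ∂(fwdPathLaw ν₀ κF)) /
          ((ν₀ univ)⁻¹ * ν₁ univ).toReal)) := by
      refine hrat.congr' ?_
      filter_upwards [eventually_gt_atTop 0] with n hn
      have hn' : (n : ℝ) ≠ 0 := by exact_mod_cast hn.ne'
      rw [Pi.div_apply, div_div_div_cancel_right₀ hn']
    exact tendsto_nhds_unique hrat' hωC
  filter_upwards [tendsto_sum_div_anyLaw_of_nHit_minorised hinv hm0 hD hφm hA μ₀,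
    h.tendsto_sampleMean_restartChain_anyLaw K h0 hK hm0 hmin μ₀] with ω hωA hωB
  rw [← hval]
  refine (hωA.div hωB hpos.ne').congr' ?_
  filter_upwards [eventually_gt_atTop 0] with n hn
  have hn' : (n : ℝ) ≠ 0 := by exact_mod_cast hn.ne'
  rw [Pi.div_apply, div_div_div_cancel_right₀ hn']

end CrooksPair

end Summit.Ventures.LatticeQCDFlow.Exactness.GeneralNCMC
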